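import Literature.NumberTheory.LFunctions.LogZetaClassicalRegionBounds
import HarnessLib

/-!
# The complex powers `ζ(s)^z` on the slit zero-free region (Tenenbaum II.5 §5.1; MV §7.4)

Topic `Literature/NumberTheory/LFunctions`. Everything here is PROVED (one definition with body,
theorems). Support for the Selberg–Delange law for `z^{Ω(n)}` (`SelbergDelangeOmega.lean`,
`Literature.NumberTheory.LFunctions.MontgomeryVaughan2007_thm_7_18_Omega`).

`LogZetaClassicalRegion.lean` builds the holomorphic logarithm `logZeta₁` of `ζ₁(s) = (s − 1)ζ(s)` on
the classical region `Ω = zfrRegion` and the REAL powers `zetaCpow μ`. The Selberg–Delange method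
needs the same object for COMPLEX exponents `z` ("`ζ(s)^z` has a branch point at `s = 1`", MV p. 178):

* `zetaPow z s = exp(z · logZeta₁ s) · (s − 1)^{−z}` (principal power), holomorphic on the slit
  region `Ω ∖ (−∞, 1]` (`differentiableOn_zetaPow`), equal to `exp(z ∑_p −Log(1 − p^{−s}))` on
  `Re s > 1` (`zetaPow_eq_exp_eulerLogZeta`) and to `exp(z (logZeta₁ s − Log(s − 1)))` off `s = 1`;
* the two bounds used on the contour: **far from `1`** (`|t| ≥ 1`), by MV Theorem 6.7,
  `‖ζ(s)^z‖ ≤ C_R (log(|t| + 3))^R` for `‖z‖ ≤ R` (`exists_norm_zetaPow_le_far`); **near `1`**, the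
  smooth factor `exp(z · logZeta₁ s)` is bounded on the box `|t| ≤ 1`, `1 − w₁/2 ≤ σ ≤ 2`
  (`exists_norm_exp_mul_logZeta₁_le`) while `‖(s − 1)^{−z}‖ ≤ ‖s − 1‖^{−Re z} e^{π|Im z|}`
  (`norm_cpow_neg_le`);
* `logZeta₁ 1 = 0`, so the smooth factor is `1` at the branch point (`logZeta₁_one`).

## References

* [MontgomeryVaughan2007] H. L. Montgomery, R. C. Vaughan, *Multiplicative Number Theory I*,
  CUP 2007, §7.4 proof of Theorem 7.17 (p. 178), Theorem 6.7.
* [Tenenbaum2015] G. Tenenbaum, *Introduction to analytic and probabilistic number theory*, 3rd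
  ed., AMS GSM 163, II.5 §5.1 (the function `Z(s; z)`).
-/

noncomputable section

open Complex Set Filter Topology Metric

namespace Literature.NumberTheory.LFunctions

namespace SelbergDelange

/-! ### Two elementary facts on principal powers -/

/-- `‖w^{−z}‖ ≤ ‖w‖^{−Re z} e^{π |Im z|}` for `w ≠ 0`. [folklore] -/
theorem norm_cpow_neg_le {w : ℂ} (hw : w ≠ 0) (z : ℂ) :
    ‖w ^ (-z)‖ ≤ ‖w‖ ^ (-z.re) * Real.exp (Real.pi * |z.im|) := by
  rw [cpow_def_of_ne_zero hw, norm_exp, Real.rpow_def_of_pos (norm_pos_iff.2 hw), ← Real.exp_add,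
    Real.exp_le_exp]
  have hre : (log w * -z).re = Real.log ‖w‖ * -z.re + (arg w) * z.im := by
    simp only [mul_re, neg_re, neg_im, log_re, log_im]
    ring
  rw [hre]
  have h1 : arg w * z.im ≤ Real.pi * |z.im| := by
    have ha : |arg w| ≤ Real.pi := abs_arg_le_pi w
    calc arg w * z.im ≤ |arg w * z.im| := le_abs_self _
      _ = |arg w| * |z.im| := abs_mul _ _
      _ ≤ Real.pi * |z.im| := by gcongr
  nlinarith

/-- `(w/L)^{a} = w^{a} · L^{−a}` for real `L > 0` (the principal arguments of `w` and `w/L`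
agree). [folklore] -/
theorem div_ofReal_cpow {w : ℂ} (hw : w ≠ 0) {L : ℝ} (hL : 0 < L) (a : ℂ) :
    (w / (L : ℂ)) ^ a = w ^ a * (L : ℂ) ^ (-a) := by
  have hL0 : (L : ℂ) ≠ 0 := ofReal_ne_zero.2 hL.ne'
  have hwL : w / (L : ℂ) ≠ 0 := div_ne_zero hw hL0
  rw [cpow_def_of_ne_zero hwL, cpow_def_of_ne_zero hw, cpow_def_of_ne_zero hL0, ← exp_add]
  congr 1
  rw [div_eq_mul_inv, ← ofReal_inv, log_mul_ofReal _ (inv_pos.2 hL) _ hw, Real.log_inv,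
    (ofReal_log hL.le).symm]
  push_cast
  ring

/-! ### `ζ(s)^z` for complex `z` -/

/-- **The branch of `ζ(s)^z`** (`z` complex) on the region slit along `(−∞, 1]`:
`zetaPow z s = exp(z · logZeta₁ s) · (s − 1)^{−z}` (principal power); on `Re s > 1` this is
`exp(z ∑_p −Log(1 − p^{−s}))`, the `z`-th power of the Euler product (`zetaPow_eq_exp_eulerLogZeta`).
[cite: Tenenbaum2015, II.5 §5.1] [cite: MontgomeryVaughan2007, §7.4 p. 178] -/
def zetaPow (z s : ℂ) : ℂ := exp (z * logZeta₁ s) * (s - 1) ^ (-z)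

/-- Unfolding. [folklore] -/
theorem zetaPow_def (z s : ℂ) : zetaPow z s = exp (z * logZeta₁ s) * (s - 1) ^ (-z) := rfl

/-- For real exponents `zetaPow` is the tree's `zetaCpow`. [folklore] -/
theorem zetaPow_ofReal (μ : ℝ) (s : ℂ) : zetaPow μ s = zetaCpow μ s := rfl

/-- `zetaPow z` is holomorphic on the slit region. [folklore] -/
theorem differentiableOn_zetaPow (z : ℂ) : DifferentiableOn ℂ (zetaPow z) zfrSlitRegion := by
  intro s hs
  have hL : DifferentiableAt ℂ logZeta₁ s :=
    differentiableOn_logZeta₁.differentiableAt (isOpen_zfrRegion.mem_nhds hs.1)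
  have h1 : DifferentiableAt ℂ (fun w ↦ exp (z * logZeta₁ w)) s := (hL.const_mul _).cexp
  have h2 : DifferentiableAt ℂ (fun w : ℂ ↦ (w - 1) ^ (-z)) s :=
    (differentiableAt_id.sub_const 1).cpow_const hs.2
  exact (h1.mul h2).differentiableWithinAt

/-- `zetaPow z` is complex differentiable at every point of the slit region. [folklore] -/
theorem differentiableAt_zetaPow (z : ℂ) {s : ℂ} (hs : s ∈ zfrSlitRegion) :
    DifferentiableAt ℂ (zetaPow z) s :=
  (differentiableOn_zetaPow z).differentiableAt (isOpen_zfrSlitRegion.mem_nhds hs)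

/-- `zetaPow z` is continuous at every point of the slit region. [folklore] -/
theorem continuousAt_zetaPow (z : ℂ) {s : ℂ} (hs : s ∈ zfrSlitRegion) :
    ContinuousAt (zetaPow z) s :=
  (differentiableAt_zetaPow z hs).continuousAt

/-- Off the branch point: `zetaPow z s = exp(z (logZeta₁ s − Log(s − 1)))`. [folklore] -/
theorem zetaPow_eq_exp {z s : ℂ} (hs1 : s ≠ 1) :
    zetaPow z s = exp (z * (logZeta₁ s - log (s - 1))) := by
  rw [zetaPow, cpow_def_of_ne_zero (sub_ne_zero.2 hs1), ← exp_add]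
  congr 1
  ring

/-- On `Re s > 1`: `zetaPow z s = exp(z · ∑_p −Log(1 − p^{−s}))`. [cite: Tenenbaum2015, II.5 §5.1] -/
theorem zetaPow_eq_exp_eulerLogZeta (z : ℂ) {s : ℂ} (hs : 1 < s.re) :
    zetaPow z s = exp (z * eulerLogZeta s) := by
  have hs1 : s ≠ 1 := fun h ↦ by rw [h] at hs; simp at hs
  rw [zetaPow_eq_exp hs1, logZeta₁_eq_eulerLogZeta_add_log hs, add_sub_cancel_right]

/-- `‖ζ(s)^z‖ ≤ exp(‖z‖ · ‖logZeta₁ s − Log(s − 1)‖)` off the branch point. [folklore] -/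
theorem norm_zetaPow_le {z s : ℂ} (hs1 : s ≠ 1) :
    ‖zetaPow z s‖ ≤ Real.exp (‖z‖ * ‖logZeta₁ s - log (s - 1)‖) := by
  rw [zetaPow_eq_exp hs1]
  calc ‖exp (z * (logZeta₁ s - log (s - 1)))‖ ≤ Real.exp ‖z * (logZeta₁ s - log (s - 1))‖ :=
        norm_exp_le_exp_norm _
    _ = Real.exp (‖z‖ * ‖logZeta₁ s - log (s - 1)‖) := by rw [norm_mul]

/-- `zetaPow z s ≠ 0` off the branch point. [folklore] -/
theorem zetaPow_ne_zero (z : ℂ) {s : ℂ} (hs1 : s ≠ 1) : zetaPow z s ≠ 0 := by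
  rw [zetaPow_eq_exp hs1]; exact exp_ne_zero _

/-- **`logZeta₁ 1 = 0`**: the logarithm is real on the real axis and `exp (logZeta₁ 1) = ζ₁(1) = 1`.
[folklore] -/
theorem logZeta₁_one : logZeta₁ 1 = 0 := by
  have h1 : ((1 : ℝ) : ℂ) ∈ zfrRegion := mem_zfrRegion_of_one_le_re (by simp)
  have him : (logZeta₁ 1).im = 0 := by simpa using logZeta₁_ofReal_im h1
  have hexp : exp (logZeta₁ 1) = 1 := by
    rw [exp_logZeta₁ (by simpa using h1), riemannZeta₁_one]
  have hre : Real.exp (logZeta₁ 1).re = 1 := by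
    have := congrArg norm hexp
    rwa [norm_exp, norm_one] at this
  have hre0 : (logZeta₁ 1).re = 0 := by
    rwa [Real.exp_eq_one_iff] at hre
  exact Complex.ext hre0 him

/-- The smooth factor at the branch point: `exp(z · logZeta₁ 1) = 1`. [folklore] -/
theorem exp_mul_logZeta₁_one (z : ℂ) : exp (z * logZeta₁ 1) = 1 := by
  rw [logZeta₁_one, mul_zero, exp_zero]

/-! ### Bounds far from `s = 1` (`|t| ≥ 1`): MV Theorem 6.7 -/

/-- **`‖ζ(s)^z‖ ≤ C_R (log(|t| + 3))^R` for `‖z‖ ≤ R`, `s ∈ Ω`, `|t| ≥ 1`** ("by Theorem 6.7,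
`ζ(s)^z ≪ (log x)^R` on the new path", MV p. 178): from
`‖logZeta₁ s − Log(s − 1)‖ ≤ log log(|t| + 3) + C₀`. [cite: MontgomeryVaughan2007, Theorem 6.7] -/
theorem exists_norm_zetaPow_le_far (R : ℝ) (hR : 0 ≤ R) :
    ∃ C : ℝ, 0 < C ∧ ∀ z s : ℂ, ‖z‖ ≤ R → s ∈ zfrRegion → 1 ≤ |s.im| →
      ‖zetaPow z s‖ ≤ C * Real.log (|s.im| + 3) ^ R := by
  obtain ⟨C₀, hC₀, hbd⟩ := SatheSelberg.exists_norm_logZeta_sub_log_le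
  refine ⟨Real.exp (R * C₀), Real.exp_pos _, fun z s hz hs ht ↦ ?_⟩
  have hs1 : s ≠ 1 := fun h ↦ by rw [h] at ht; simp at ht; linarith
  set ℓ : ℝ := Real.log (|s.im| + 3) with hℓ
  have hℓ1 : 1 < ℓ := ZetaClassicalRegion.one_lt_log_abs_add_three s.im
  have hℓ0 : 0 < ℓ := by linarith
  have hlogℓ : 0 ≤ Real.log ℓ := Real.log_nonneg hℓ1.le
  have h := hbd s hs ht
  calc ‖zetaPow z s‖ ≤ Real.exp (‖z‖ * ‖logZeta₁ s - log (s - 1)‖) := norm_zetaPow_le hs1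
    _ ≤ Real.exp (R * (Real.log ℓ + C₀)) := by
        rw [Real.exp_le_exp]
        exact mul_le_mul hz h (norm_nonneg _) hR
    _ = Real.exp (R * C₀) * ℓ ^ R := by
        rw [mul_add, Real.exp_add, Real.rpow_def_of_pos hℓ0, mul_comm (Real.log ℓ) R]
        ring

/-! ### Bounds near `s = 1` -/

/-- **The smooth factor is bounded near `s = 1`**: there is `C_R > 0` with
`‖exp(z · logZeta₁ s)‖ ≤ C_R` for `‖z‖ ≤ R` on the box `|t| ≤ 1`, `1 − zfrWidth 1/2 ≤ σ ≤ 2`.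
[folklore] -/
theorem exists_norm_exp_mul_logZeta₁_le (R : ℝ) (hR : 0 ≤ R) :
    ∃ C : ℝ, 0 < C ∧ ∀ z s : ℂ, ‖z‖ ≤ R → |s.im| ≤ 1 → 1 - zfrWidth 1 / 2 ≤ s.re → s.re ≤ 2 →
      ‖exp (z * logZeta₁ s)‖ ≤ C := by
  obtain ⟨M, hM0, hM⟩ := SatheSelberg.exists_norm_logZeta₁_le_near_one
  refine ⟨Real.exp (R * M), Real.exp_pos _, fun z s hz ht h1 h2 ↦ ?_⟩
  calc ‖exp (z * logZeta₁ s)‖ ≤ Real.exp ‖z * logZeta₁ s‖ := norm_exp_le_exp_norm _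
    _ ≤ Real.exp (R * M) := by
        rw [Real.exp_le_exp, norm_mul]
        exact mul_le_mul hz (hM s ht h1 h2) (norm_nonneg _) hR

/-- The box `|t| ≤ 1`, `1 − zfrWidth 1/2 ≤ σ ≤ 2` lies in the region. [folklore] -/
theorem mem_zfrRegion_of_box {s : ℂ} (ht : |s.im| ≤ 1) (h1 : 1 - zfrWidth 1 / 2 ≤ s.re)
    (h2 : s.re ≤ 2) : s ∈ zfrRegion :=
  SatheSelberg.box_subset_zfrRegion ⟨⟨h1, h2⟩, abs_le.1 ht⟩

/-- **Near `s = 1`**: `‖ζ(s)^z‖ ≤ C_R ‖s − 1‖^{−Re z} e^{π|Im z|}` for `‖z‖ ≤ R` on the box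
`|t| ≤ 1`, `1 − zfrWidth 1/2 ≤ σ ≤ 2`, `s ≠ 1` ("on `C₂` we have `ζ(s)^z/s = (s−1)^{−z}(1+O(|s−1|))`",
MV p. 178 — here only the crude form). [cite: MontgomeryVaughan2007, §7.4 p. 178] -/
theorem exists_norm_zetaPow_le_near (R : ℝ) (hR : 0 ≤ R) :
    ∃ C : ℝ, 0 < C ∧ ∀ z s : ℂ, ‖z‖ ≤ R → |s.im| ≤ 1 → 1 - zfrWidth 1 / 2 ≤ s.re → s.re ≤ 2 →
      s ≠ 1 → ‖zetaPow z s‖ ≤ C * (‖s - 1‖ ^ (-z.re) * Real.exp (Real.pi * |z.im|)) := by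
  obtain ⟨C, hC, hbd⟩ := exists_norm_exp_mul_logZeta₁_le R hR
  refine ⟨C, hC, fun z s hz ht h1 h2 hs1 ↦ ?_⟩
  rw [zetaPow, norm_mul]
  exact mul_le_mul (hbd z s hz ht h1 h2) (norm_cpow_neg_le (sub_ne_zero.2 hs1) z)
    (norm_nonneg _) hC.le

/-- The exponential factor `e^{π|Im z|} ≤ e^{πR}` for `‖z‖ ≤ R`. [folklore] -/
theorem exp_pi_mul_abs_im_le {z : ℂ} {R : ℝ} (hz : ‖z‖ ≤ R) :
    Real.exp (Real.pi * |z.im|) ≤ Real.exp (Real.pi * R) := by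
  rw [Real.exp_le_exp]
  exact mul_le_mul_of_nonneg_left ((abs_im_le_norm z).trans hz) Real.pi_pos.le

/-- `‖w‖^{−Re z} ≤ m^{−R} + M^{R}` when `0 < m ≤ ‖w‖ ≤ M`, `1 ≤ M`, `m ≤ 1` and `|Re z| ≤ R`: the two
regimes of the sign of `Re z`. [folklore] -/
theorem rpow_neg_re_le_add {w : ℂ} {m M R : ℝ} {z : ℂ} (hm : 0 < m) (hmw : m ≤ ‖w‖) (hwM : ‖w‖ ≤ M)
    (hM : 1 ≤ M) (hm1 : m ≤ 1) (hz : |z.re| ≤ R) :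
    ‖w‖ ^ (-z.re) ≤ m ^ (-R) + M ^ R := by
  have hw : 0 < ‖w‖ := hm.trans_le hmw
  have hR : 0 ≤ R := (abs_nonneg _).trans hz
  rcases le_or_gt 0 z.re with hre | hre
  · -- `Re z ≥ 0`: `‖w‖^{−Re z} ≤ m^{−Re z} ≤ m^{−R}`
    have h1 : ‖w‖ ^ (-z.re) ≤ m ^ (-z.re) :=
      Real.rpow_le_rpow_of_nonpos hm hmw (by linarith)
    have h2 : m ^ (-z.re) ≤ m ^ (-R) :=
      Real.rpow_le_rpow_of_exponent_ge hm hm1 (by linarith [le_abs_self z.re])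
    linarith [Real.rpow_nonneg (by linarith : (0:ℝ) ≤ M) R]
  · -- `Re z < 0`: `‖w‖^{−Re z} ≤ M^{−Re z} ≤ M^{R}`
    have h1 : ‖w‖ ^ (-z.re) ≤ M ^ (-z.re) :=
      Real.rpow_le_rpow hw.le hwM (by linarith)
    have h2 : M ^ (-z.re) ≤ M ^ R :=
      Real.rpow_le_rpow_of_exponent_le hM (by linarith [neg_abs_le z.re, abs_of_neg hre])
    linarith [Real.rpow_nonneg hm.le (-R)]

end SelbergDelange

end Literature.NumberTheory.LFunctions
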